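import Summits.Ventures.CertifiedManyBodySolver.Theorems.M3x2EdgeSplitSymReplayPackedNF
import HarnessLib

/-!
# SymReplay checker — E4(b) PACKED NORMAL-FORM / COLLECTOR TWIN, part 2: THE BRIDGE (packed stage = code of the tree stage)

(team lb-sym, cell hub-lb; engine item «E4 bridge» (crit-1 V154); signatures = hub-lb-sym-plan-1's `E4Spec_symplan1.lean`
§(b)(d2); proofs by hub-lb-sym-eng-4 g2.  ADDITIVE on part 1 `…SymReplayPackedNF`; nothing landed is touched.)

CONTENTS.  (d) Prop forms `InB lo hi w` / `PInB lo hi p` of the tree's `inBox` / `psuppInB` (`inBox_iff`, `psuppInB_iff`)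
and their propagation through every tree stage (`PInB.insL/nfWord/pscale/nfPoly/mergeF/mergePairs/mergeAll/sortW/mergeAdj/
collect/dropZeros`, from the landed `insL_letters`, `nfWord_letters`, `mergeF_perm`, `mergeAll_perm`, `sortW_perm`,
`mem_mergeAdj`); (e) THE BRIDGE, every lemma by structural induction through part 1's order isomorphism (standard axioms, no
`native_decide`): `pinsL_agree`, **`pnfWord_agree : InB lo hi w → pnfWord (encW lo hi w) = encP lo hi (nfWord w)`**,
`pwordEq_agree`, `pwordLt_agree`, `pmergeF_agree`, `pmergePairs_agree`, `pmergeAll_agree`, `psortW_agree`, `pmergeAdj_agree`,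
**`pcollect2_agree : PInB lo hi p → pcollect2 (encP lo hi p) = encP lo hi (collect p)`**, `pdropZeros_agree`, `pnfPoly_agree`,
**`pisZero_encP : PInB lo hi p → pisZero (encP lo hi p) = isZero p`**, and the primed `inBox`/`psuppInB` Boolean-hypothesis
forms (pen's signatures).  Consumer: the packed twin of the E5 hinted box pipe (`…SymReplayPackedHB`, next), whose transfer
lemma turns a `native_decide` fact on packed data into the tree's `outOKHBZ … = true`.

HONEST FRAMING: refinement lemmas between two executables (a checker COST lever); no certificate lands by this file; no bound
of record moves; no summit or crux statement is proved here; nothing here predicts superconductivity.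
-/

namespace Summit.Ventures.CertifiedManyBodySolver.Theorems.SymReplay.PackedNF

open Literature.Probability.LatticeModels (Site)
open Summit.Ventures.CertifiedManyBodySolver.Theorems.SymReplay

/-! ## (d) Box predicates (Prop forms of `inBox` / `psuppInB`) and their propagation through the tree pipe -/

section Box

variable {lo hi : ℤ × ℤ}

/-- Every letter of `w` lies in the box (Prop form). -/
def InB (lo hi : ℤ × ℤ) (w : Word) : Prop := ∀ ℓ ∈ w, inBoxSite lo hi ℓ.x = true

/-- Every word of `p` lies in the box (Prop form). -/
def PInB (lo hi : ℤ × ℤ) (p : QPoly) : Prop := ∀ t ∈ p, InB lo hi t.2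

/-- `inBox` is the letterwise `inBoxSite` test (definitional). -/
theorem inBox_eq_all (w : Word) : inBox lo hi w = w.all fun ℓ => inBoxSite lo hi ℓ.x := rfl

/-- `inBox = true` iff `InB`. -/
theorem inBox_iff (w : Word) : inBox lo hi w = true ↔ InB lo hi w := by
  rw [inBox_eq_all, List.all_eq_true]; rfl

/-- `psuppInB = true` iff `PInB`. -/
theorem psuppInB_iff (p : QPoly) : psuppInB lo hi p = true ↔ PInB lo hi p := by
  unfold psuppInB PInB
  rw [List.all_eq_true]
  exact forall₂_congr fun t _ => inBox_iff t.2

/-- The empty word is in every box. -/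
theorem InB.nil : InB lo hi [] := fun _ h => by cases h

/-- A cons is in the box iff its head site and its tail are. -/
theorem InB.cons_iff {ℓ : Letter} {w : Word} : InB lo hi (ℓ :: w) ↔ inBoxSite lo hi ℓ.x = true ∧ InB lo hi w := by
  simp [InB]

/-- Sub-words of box words are box words. -/
theorem InB.mono {u w : Word} (h : u ⊆ w) (hw : InB lo hi w) : InB lo hi u := fun ℓ hℓ => hw ℓ (h hℓ)

/-- The empty polynomial is in every box. -/
theorem PInB.nil : PInB lo hi [] := fun _ h => by cases h

/-- A cons is in the box iff its head word and its tail are. -/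
theorem PInB.cons_iff {t : ℚ × Word} {p : QPoly} : PInB lo hi (t :: p) ↔ InB lo hi t.2 ∧ PInB lo hi p := by
  simp [PInB]

/-- A concatenation is in the box iff both parts are. -/
theorem PInB.append_iff {p q : QPoly} : PInB lo hi (p ++ q) ↔ PInB lo hi p ∧ PInB lo hi q := by
  simp only [PInB, List.mem_append]
  exact ⟨fun h => ⟨fun t ht => h t (Or.inl ht), fun t ht => h t (Or.inr ht)⟩, fun h t ht => ht.elim (h.1 t) (h.2 t)⟩

/-- Box membership is invariant under permutation. -/
theorem PInB.of_perm {p q : QPoly} (h : p.Perm q) (hq : PInB lo hi q) : PInB lo hi p := fun t ht => hq t (h.mem_iff.1 ht)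

/-- `insL` keeps words in the box. -/
theorem PInB.insL {ℓ : Letter} {u : Word} (hℓ : inBoxSite lo hi ℓ.x = true) (hu : InB lo hi u) :
    PInB lo hi (insL ℓ u) := fun t ht => (InB.cons_iff.2 ⟨hℓ, hu⟩).mono (insL_letters ℓ u t ht)

/-- `nfWord` keeps words in the box. -/
theorem PInB.nfWord {w : Word} (hw : InB lo hi w) : PInB lo hi (nfWord w) := fun t ht => hw.mono (nfWord_letters w t ht)

/-- `pscale` keeps words in the box. -/
theorem PInB.pscale {q : ℚ} {p : QPoly} (hp : PInB lo hi p) : PInB lo hi (pscale q p) := by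
  intro t ht
  simp only [SymReplay.pscale, List.mem_map] at ht
  obtain ⟨s, hs, rfl⟩ := ht
  exact hp s hs

/-- `nfPoly` keeps words in the box. -/
theorem PInB.nfPoly {p : QPoly} (hp : PInB lo hi p) : PInB lo hi (nfPoly p) := by
  intro t ht
  simp only [SymReplay.nfPoly, List.mem_flatMap] at ht
  obtain ⟨s, hs, ht⟩ := ht
  exact (PInB.nfWord (hp s hs)).pscale t ht

/-- `mergeF` keeps words in the box. -/
theorem PInB.mergeF {n : ℕ} {p q : QPoly} (hp : PInB lo hi p) (hq : PInB lo hi q) : PInB lo hi (mergeF n p q) :=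
  PInB.of_perm (mergeF_perm n p q) (PInB.append_iff.2 ⟨hp, hq⟩)

/-- `mergePairs` keeps every run in the box. -/
theorem PInB.mergePairs {n : ℕ} : ∀ {l : List QPoly}, (∀ p ∈ l, PInB lo hi p) → ∀ p ∈ mergePairs n l, PInB lo hi p
  | [], _ => fun p hp => by cases hp
  | [p], h => by simpa [SymReplay.mergePairs] using h
  | p :: q :: rest, h => by
    intro r hr
    simp only [SymReplay.mergePairs, List.mem_cons] at hr
    rcases hr with rfl | hr
    · exact PInB.mergeF (h p (by simp)) (h q (by simp))
    · exact PInB.mergePairs (fun p' hp' => h p' (by simp [hp'])) r hr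

/-- `mergeAll` keeps words in the box. -/
theorem PInB.mergeAll {k n : ℕ} {l : List QPoly} (h : ∀ p ∈ l, PInB lo hi p) : PInB lo hi (mergeAll k n l) := by
  refine PInB.of_perm (mergeAll_perm k n l) ?_
  intro t ht
  rw [List.mem_flatten] at ht
  obtain ⟨p, hp, ht⟩ := ht
  exact h p hp t ht

/-- `sortW` keeps words in the box. -/
theorem PInB.sortW {p : QPoly} (hp : PInB lo hi p) : PInB lo hi (sortW p) := PInB.of_perm (sortW_perm p) hp

/-- `mergeAdj` keeps words in the box. -/
theorem PInB.mergeAdj {p : QPoly} (hp : PInB lo hi p) : PInB lo hi (mergeAdj p) := by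
  intro t ht
  obtain ⟨s, hs, hst⟩ := mem_mergeAdj p t ht
  rw [← hst]
  exact hp s hs

/-- `collect` keeps words in the box. -/
theorem PInB.collect {p : QPoly} (hp : PInB lo hi p) : PInB lo hi (collect p) := (PInB.sortW hp).mergeAdj

/-- `dropZeros` keeps words in the box. -/
theorem PInB.dropZeros {p : QPoly} (hp : PInB lo hi p) : PInB lo hi (dropZeros p) :=
  fun t ht => hp t (List.mem_of_mem_filter ht)

end Box

/-! ## (e) The bridge: packed stage = code of the tree stage, inside the box -/

section Bridge

variable {lo hi : ℤ × ℤ}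

/-- Code of the empty word. -/
@[simp] theorem encW_nil : encW lo hi [] = [] := rfl
/-- Code of a cons. -/
@[simp] theorem encW_cons (ℓ : Letter) (w : Word) : encW lo hi (ℓ :: w) = encL lo hi ℓ :: encW lo hi w := rfl
/-- Code of the empty polynomial. -/
@[simp] theorem encP_nil : encP lo hi [] = [] := rfl
/-- Code of a cons. -/
@[simp] theorem encP_cons (t : ℚ × Word) (p : QPoly) : encP lo hi (t :: p) = (t.1, encW lo hi t.2) :: encP lo hi p := rfl
/-- Code of a concatenation. -/
theorem encP_append (p q : QPoly) : encP lo hi (p ++ q) = encP lo hi p ++ encP lo hi q := List.map_append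
/-- The code keeps the number of terms. -/
theorem encP_length (p : QPoly) : (encP lo hi p).length = p.length := List.length_map _

/-- `consNeg` through the code. -/
theorem pconsNeg_encP (m : Letter) (p : QPoly) : pconsNeg (encL lo hi m) (encP lo hi p) = encP lo hi (consNeg m p) := by
  unfold pconsNeg consNeg encP
  simp [List.map_map, Function.comp_def]

/-- `pscale` through the code. -/
theorem ppscale_encP (q : ℚ) (p : QPoly) : ppscale q (encP lo hi p) = encP lo hi (pscale q p) := by
  unfold ppscale pscale encP
  simp [List.map_map, Function.comp_def]

/-- A `flatMap` over a mapped list. -/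
theorem flatMap_map_left {α β γ : Type} (l : List α) (e : α → β) (F : β → List γ) :
    (l.map e).flatMap F = l.flatMap fun a => F (e a) := by
  induction l with
  | nil => rfl
  | cons a l ih => simp [List.flatMap_cons, ih]

/-- Mapping a `flatMap`. -/
theorem map_flatMap' {α β γ : Type} (l : List α) (T : α → List β) (e : β → γ) :
    (l.flatMap T).map e = l.flatMap fun a => (T a).map e := by
  induction l with
  | nil => rfl
  | cons a l ih => simp [List.flatMap_cons, ih]

/-- **(b1)** `insL` agreement. -/
theorem pinsL_agree (ℓ : Letter) (hℓ : inBoxSite lo hi ℓ.x = true) :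
    ∀ (w : Word), InB lo hi w → pinsL (encL lo hi ℓ) (encW lo hi w) = encP lo hi (insL ℓ w)
  | [], _ => by simp [pinsL, insL, encP, encW]
  | m :: rest, hw => by
    have hm : inBoxSite lo hi m.x = true := (InB.cons_iff.1 hw).1
    have hrest : InB lo hi rest := (InB.cons_iff.1 hw).2
    have ih := pinsL_agree ℓ hℓ rest hrest
    simp only [encW_cons, pinsL, insL, pdag_encL, pmodeEq_encL hℓ hm, pmodeLt_encL hℓ hm]
    split_ifs <;> simp [ih, pconsNeg_encP]

/-- **(b2)** `nfWord` agreement: the packed normal form of a box word is the code of its normal form. -/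
theorem pnfWord_agree : ∀ (w : Word), InB lo hi w → pnfWord (encW lo hi w) = encP lo hi (nfWord w)
  | [], _ => by simp [pnfWord, nfWord, encP, encW]
  | ℓ :: rest, hw => by
    have hℓ : inBoxSite lo hi ℓ.x = true := (InB.cons_iff.1 hw).1
    have hrest : InB lo hi rest := (InB.cons_iff.1 hw).2
    have ih := pnfWord_agree rest hrest
    simp only [encW_cons, pnfWord, nfWord, ih]
    unfold encP
    rw [flatMap_map_left, map_flatMap']
    refine List.flatMap_congr fun t ht => ?_
    have htb : InB lo hi t.2 := hrest.mono (nfWord_letters rest t ht)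
    have h1 := pinsL_agree ℓ hℓ t.2 htb
    unfold encP at h1
    simp only [h1, List.map_map, Function.comp_def]

/-- `nfWord` agreement, `inBox` form (pen's E4Spec (b2) signature). -/
theorem pnfWord_agree' (w : Word) (hw : inBox lo hi w = true) : pnfWord (encW lo hi w) = encP lo hi (nfWord w) :=
  pnfWord_agree w ((inBox_iff w).1 hw)

/-- **(b3-eq)** `wordEq` agreement. -/
theorem pwordEq_agree : ∀ (u v : Word), InB lo hi u → InB lo hi v →
    pwordEq (encW lo hi u) (encW lo hi v) = wordEq u v
  | [], [], _, _ => rfl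
  | [], _ :: _, _, _ => rfl
  | _ :: _, [], _, _ => rfl
  | a :: u, b :: v, hu, hv => by
    have ha := (InB.cons_iff.1 hu).1
    have hb := (InB.cons_iff.1 hv).1
    simp only [encW_cons, pwordEq, wordEq, beq_encL ha hb, pwordEq_agree u v (InB.cons_iff.1 hu).2 (InB.cons_iff.1 hv).2]

/-- **(b3-lt)** `wordLt` agreement. -/
theorem pwordLt_agree : ∀ (u v : Word), InB lo hi u → InB lo hi v →
    pwordLt (encW lo hi u) (encW lo hi v) = wordLt u v
  | [], [], _, _ => rfl
  | [], _ :: _, _, _ => rfl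
  | _ :: _, [], _, _ => rfl
  | a :: u, b :: v, hu, hv => by
    have ha := (InB.cons_iff.1 hu).1
    have hb := (InB.cons_iff.1 hv).1
    simp only [encW_cons, pwordLt, wordLt, blt_encL ha hb, beq_encL ha hb,
      pwordLt_agree u v (InB.cons_iff.1 hu).2 (InB.cons_iff.1 hv).2]

/-- **(b4-merge)** `mergeF` agreement. -/
theorem pmergeF_agree : ∀ (n : ℕ) (p q : QPoly), PInB lo hi p → PInB lo hi q →
    pmergeF n (encP lo hi p) (encP lo hi q) = encP lo hi (mergeF n p q)
  | 0, p, q, _, _ => by simp [pmergeF, mergeF, encP_append]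
  | _ + 1, [], q, _, _ => by simp [pmergeF, mergeF]
  | _ + 1, t :: p, [], _, _ => by simp [pmergeF, mergeF]
  | n + 1, t :: p, t' :: q, hp, hq => by
    have ht := (PInB.cons_iff.1 hp).1
    have ht' := (PInB.cons_iff.1 hq).1
    simp only [encP_cons, pmergeF, mergeF, pwordLt_agree t'.2 t.2 ht' ht]
    split
    · simp only [encP_cons, List.cons.injEq, true_and]
      exact pmergeF_agree n (t :: p) q hp (PInB.cons_iff.1 hq).2
    · simp only [encP_cons, List.cons.injEq, true_and]
      exact pmergeF_agree n p (t' :: q) (PInB.cons_iff.1 hp).2 hq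

/-- **(b4-pairs)** `mergePairs` agreement. -/
theorem pmergePairs_agree (n : ℕ) : ∀ (l : List QPoly), (∀ p ∈ l, PInB lo hi p) →
    pmergePairs n (l.map (encP lo hi)) = (mergePairs n l).map (encP lo hi)
  | [], _ => rfl
  | [p], _ => rfl
  | p :: q :: rest, h => by
    simp only [List.map_cons, pmergePairs, mergePairs]
    rw [pmergeF_agree n p q (h p (by simp)) (h q (by simp)), pmergePairs_agree n rest fun r hr => h r (by simp [hr])]

/-- `encP` of a concatenation of runs. -/
theorem encP_foldr_append (l : List QPoly) :
    encP lo hi (l.foldr (· ++ ·) []) = (l.map (encP lo hi)).foldr (· ++ ·) [] := by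
  induction l with
  | nil => rfl
  | cons p l ih => simp [encP_append, ih]

/-- **(b4-all)** `mergeAll` agreement. -/
theorem pmergeAll_agree : ∀ (k n : ℕ) (l : List QPoly), (∀ p ∈ l, PInB lo hi p) →
    pmergeAll k n (l.map (encP lo hi)) = encP lo hi (mergeAll k n l)
  | _, _, [], _ => by simp [pmergeAll, mergeAll]
  | _, _, [p], _ => by simp [pmergeAll, mergeAll]
  | 0, n, p :: q :: rest, _ => by
    simp only [List.map_cons, pmergeAll, mergeAll]
    rw [encP_foldr_append]
    simp
  | k + 1, n, p :: q :: rest, h => by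
    have e1 : (p :: q :: rest).map (encP lo hi) = encP lo hi p :: encP lo hi q :: rest.map (encP lo hi) := rfl
    rw [e1]
    simp only [pmergeAll, mergeAll]
    rw [← e1, pmergePairs_agree n _ h, pmergeAll_agree k n _ (fun r hr => PInB.mergePairs h r hr)]

/-- **(b4-sort)** `sortW` agreement. -/
theorem psortW_agree (p : QPoly) (hp : PInB lo hi p) : psortW (encP lo hi p) = encP lo hi (sortW p) := by
  unfold psortW sortW
  rw [encP_length]
  have hmap : (encP lo hi p).map (fun t => [t]) = (p.map fun t => [t]).map (encP lo hi) := by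
    unfold encP; simp [List.map_map, Function.comp_def]
  rw [hmap]
  exact pmergeAll_agree _ _ _ fun r hr => by
    rw [List.mem_map] at hr
    obtain ⟨t, ht, rfl⟩ := hr
    exact PInB.cons_iff.2 ⟨hp t ht, PInB.nil⟩

/-- **(b4-adj)** `mergeAdj` agreement. -/
theorem pmergeAdj_agree : ∀ (p : QPoly), PInB lo hi p → pmergeAdj (encP lo hi p) = encP lo hi (mergeAdj p)
  | [], _ => rfl
  | t :: rest, hp => by
    have ht := (PInB.cons_iff.1 hp).1
    have hrest := (PInB.cons_iff.1 hp).2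
    have ih := pmergeAdj_agree rest hrest
    simp only [encP_cons, pmergeAdj, mergeAdj, ih]
    rcases hm : mergeAdj rest with _ | ⟨t', rest'⟩
    · simp [encP]
    · have ht' : InB lo hi t'.2 := (PInB.mergeAdj hrest) t' (by simp [hm])
      simp only [encP_cons, pwordEq_agree t.2 t'.2 ht ht']
      split <;> simp [encP]

/-- **(b4)** collector agreement: the packed collector on coded input is the code of the tree collector. -/
theorem pcollect2_agree (p : QPoly) (hp : PInB lo hi p) : pcollect2 (encP lo hi p) = encP lo hi (collect p) := by
  unfold pcollect2 collect
  rw [psortW_agree p hp, pmergeAdj_agree _ (PInB.sortW hp)]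

/-- Collector agreement, `psuppInB` form (pen's E4Spec (b4) signature). -/
theorem pcollect2_agree' (p : QPoly) (hp : psuppInB lo hi p = true) :
    pcollect2 (encP lo hi p) = encP lo hi (collect p) :=
  pcollect2_agree p ((psuppInB_iff p).1 hp)

/-- **(b5)** zero-filter agreement (no box hypothesis). -/
theorem pdropZeros_agree (p : QPoly) : pdropZeros (encP lo hi p) = encP lo hi (dropZeros p) := by
  unfold pdropZeros dropZeros encP
  rw [List.filter_map]
  rfl

/-- `nfPoly` agreement. -/
theorem pnfPoly_agree (p : QPoly) (hp : PInB lo hi p) : pnfPoly (encP lo hi p) = encP lo hi (nfPoly p) := by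
  unfold pnfPoly nfPoly
  conv_lhs => rw [encP, flatMap_map_left]
  conv_rhs => rw [encP, map_flatMap']
  refine List.flatMap_congr fun t ht => ?_
  show ppscale t.1 (pnfWord (encW lo hi t.2)) = encP lo hi (pscale t.1 (nfWord t.2))
  rw [pnfWord_agree t.2 (hp t ht), ppscale_encP]

/-- **(d2)** the zero test through the code. -/
theorem pisZero_encP (p : QPoly) (hp : PInB lo hi p) : pisZero (encP lo hi p) = isZero p := by
  unfold pisZero isZero
  rw [pcollect2_agree p hp]
  unfold encP
  rw [List.all_map]
  rfl

/-- The zero test through the code, `psuppInB` form (pen's E4Spec (d2) signature). -/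
theorem pisZero_encP' (p : QPoly) (hp : psuppInB lo hi p = true) : pisZero (encP lo hi p) = isZero p :=
  pisZero_encP p ((psuppInB_iff p).1 hp)

end Bridge

end Summit.Ventures.CertifiedManyBodySolver.Theorems.SymReplay.PackedNF
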